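import Summits.QuantumFields.BalabanUV.Beta.GAN24.Push4FrozenLayers
import Summits.QuantumFields.BalabanUV.Beta.GAN24.EnvelopeBlockSum

/-!
# `BalabanUV.Beta.GAN24.Push4Oscillation` — binder row G-an2-4 / (CONV-C), W-slot road «W3», ROW W3-F3b (T-irr) (gan24-p1-g5 `SKELETON-W3.md` v1.0.2 §8.6
# (F3-core-b); journal INTENT «W3-TIRR*» l.7944), core part 5a: THE OSCILLATION TOOLS — the (N1)∕(N1′)-type leg envelopes in relative form about a
# base point, the cell oscillation of the four-leg product, the sublattice sum of the four envelopes, and the abstract OSCILLATION STEP (a summable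
# weight against an `Lc`-periodic function of zero cell sum sees only the weight's cell oscillation); part 5b `GAN24/Push4Irr` = the core itself

NOT IN PRINT; OUR PROOF ATTEMPT (the analytic core of ROW W3-F3b; [folklore] real analysis over leaf-17's `Push4` carrier, leaf-02's `zmode`, and parts 1–4
`LatticeFreeze` ∕ `EnvelopeBlockSum` ∕ `Push4Slices` ∕ `Push4Frozen`; ONE plumbing `def` (`cIrr`, the displayed constant) asserting nothing; 0 cited facts,
0 `def … : Prop`, 0 wall binders).  HONEST FRAMING (cell contract, verbatim): «discharging `BetaPertH` makes Bałaban's UV stability UNCONDITIONAL — a real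
constructive-QFT result; it is NOT the continuum limit and NOT the Clay problem.»  HONEST DEPENDENCY (verbatim): «continuum YM on T⁴ ⇐ BetaPertH ∧ nine spine
estimates (0/9 proved); BetaPertH ⇐ (D1) ∧ (D4) ∧ CAP+tail; G-an2-4 gates asym, D1 and NE2/3/4.»  THIS IS NOT THE ROW: the row (T-irr) = this core ∘ the first
general step (R14-7) ∘ `Push4Nest` ∘ `RespStepSemigroup` ∘ `RespStepDecay` ∘ arithmetic; discharges NOTHING of «T2Shape» ∕ «T2SupRate» ∕ (hW₂, hW₂all);
NOT «W-slot closed», NEVER «G-an2-4 closed»; NOT `BetaPertH`, NOT continuum, NOT Clay.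

## The mechanism (SKELETON-W3 §7.3 (T-irr), (N-F3b))
Read the push with the first table bond `u` outermost (`Push4Slices.push₄_eq_vertexW_push₃`).  For each `u`, freeze the three inner legs at `u`
(`Push4Frozen.abs_push₃_sub_frozen_le`): the remainder carries one Lipschitz allowance `a′` (= one `L⁻¹`); the frozen term is `Λ(u)·S(u)` with `Λ` the product
of the four legs at `u` and `S(u) = sliceSum X κ u …` the slice charge — `Lc`-PERIODIC by joint covariance and of ZERO CELL SUM by `zmode = 0`.  A weight against a
periodic zero-mean function only sees its CELL OSCILLATION (`BiStencilZeroMode.tsum_mul_periodic`): `Σ'_u Λ·S = Σ_{b ∈ cell} S(b)·Σ'_t (Λ(Lc•t + b) − Λ(Lc•t))`,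
and the oscillation of a product of four block-smooth legs over one `Lc`-cell costs one unit-gradient allowance `a′` times `(d+1)·Lc` steps.  The one free block
sum of the four envelopes is `L^{d+1}` (`EnvelopeBlockSum.tsum_env4_le`), with the output decay.

## What is proved (generic `d`; `L ≥ 1` the relative blocking of the legs, `Lc ≥ 1` the period of the table)
* §1 `leg_rel_sup` ∕ `leg_rel_lip` — the (N1)∕(N1′)-type envelopes at RELATIVE form about any base point (wobble + lattice paths); `summable_leg`, `leg_abs_le`.
* §2 `abs_prod_four_sub_le` (product rule), `l1_toSite_le`, `abs_legs4_sub_le` (cell oscillation of the four-leg product), `tsum_env4_sublattice_le`.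
* §3 **`abs_tsum_mul_periodic_zero_le`** — THE OSCILLATION STEP (abstract): a summable weight against an `Lc`-periodic function of zero cell sum.
(§4 = part 5b `GAN24/Push4Irr`: `cIrr`, `frozen4`, the per-slice and summed remainder ∕ frozen parts, and the core `push₄_locStencil₂_of_zff(_env)`.)
Unit `b2b-balaban-gan24-formalise-leaf-12` (G-an2-4 formalisation swarm, leaf prover 12, gen 20; ROW W3-F3b holder), 2026-08-20.
-/

noncomputable section

open Finset
open scoped BigOperators
open Literature.MathematicalPhysics.QuantumFieldTheory
open Literature.MathematicalPhysics.QuantumFieldTheory.LatticeForm (quo)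
open Literature.MathematicalPhysics.QuantumFieldTheory.Balaban1983to89
open Literature.MathematicalPhysics.QuantumFieldTheory.Balaban1983to89.Beta
open B4ContourShift (supNorm abs_le_supNorm supNorm_nonneg exists_supNorm_eq)
open B12Sec2to5 (l1 l1_nonneg)
open ExpKernelCalculus (MKer comp Zl Zl_nonneg Zl_pos summable_exp_shift summable_exp_shift' tsum_exp_shift tsum_exp_shift' l1_sub_triangle l1_sub_symm shiftK
  BiLoc)
open OneStepResolventKernel (Fib)
open BalabanCompositeJets (LocStencil₂ LocStencil₂.nonneg)
open AffineAveraging (box toSite)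
open InterLevelTransport (sublattice_injective)
open Summit.QuantumFields.BalabanUV.Beta.GAN24.Push4 (vertexW vertexW_apply push₄ push₄_def ffRead_inr_left ffRead_inr_right)
open Summit.QuantumFields.BalabanUV.Beta.GAN24.Push4Slices (push₃ sliceSum push₄_inl_inl_eq_tsum sliceSum_add_zsmul zmode_inl_inl_eq_sum_sliceSum
  abs_sliceSum_le)
open Summit.QuantumFields.BalabanUV.Beta.GAN24.Push4FrozenLayers (summable_of_abs_le_exp abs_tsum_le_of_abs_le_exp abs_base_le)
open Summit.QuantumFields.BalabanUV.Beta.GAN24.BiStencilZeroMode (Tab zmode tsum_eq_sum_box_tsum tsum_mul_periodic)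
open Summit.QuantumFields.BalabanUV.Beta.GAN24.LatticeFreeze (abs_sub_le_of_unit_steps)
open Summit.QuantumFields.BalabanUV.Beta.GAN24.EnvelopeBlockSum (env_wobble env_le_one summable_env tsum_env4_le)

namespace Summit.QuantumFields.BalabanUV.Beta.GAN24.Push4Oscillation

variable {d : ℕ}

/-! ## §1 The envelopes in relative form about a base point -/

section Legs

variable {g : Fin (d + 1) → (Fin (d + 1) → ℤ) → Fin (d + 1) → (Fin (d + 1) → ℤ) → ℝ} {L : ℕ} {κ₀ a a' : ℝ}

/-- [folklore] **SUP ENVELOPE IN RELATIVE FORM**: `|g μ z κ v| ≤ (a·E_z(u))·e^{κ₀|v−u|₁}` about ANY base point `u` (`EnvelopeBlockSum.env_wobble`). -/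
theorem leg_rel_sup (hL : 1 ≤ L) (hκ : 0 ≤ κ₀) (ha : 0 ≤ a)
    (hg : ∀ μ z κ v, |g μ z κ v| ≤ a * Real.exp (-(κ₀ * supNorm (quo L v - z))))
    (μ : Fin (d + 1)) (z : Fin (d + 1) → ℤ) (κ : Fin (d + 1)) (u v : Fin (d + 1) → ℤ) :
    |g μ z κ v| ≤ (a * Real.exp (-(κ₀ * supNorm (quo L u - z)))) * Real.exp (κ₀ * l1 (v - u)) := by
  refine (hg μ z κ v).trans ?_
  have hw := env_wobble (d := d) hL hκ z u v
  calc a * Real.exp (-(κ₀ * supNorm (quo L v - z)))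
      ≤ a * (Real.exp (κ₀ * l1 (v - u)) * Real.exp (-(κ₀ * supNorm (quo L u - z)))) := mul_le_mul_of_nonneg_left hw ha
    _ = _ := by ring

/-- [folklore] **UNIT-GRADIENT ENVELOPE IN RELATIVE (LIPSCHITZ) FORM**: `|g μ z κ v − g μ z κ u| ≤ (a′·E_z(u))·|v−u|₁·e^{κ₀|v−u|₁}`
(`env_wobble` + `LatticeFreeze.abs_sub_le_of_unit_steps`). -/
theorem leg_rel_lip (hL : 1 ≤ L) (hκ : 0 ≤ κ₀) (ha' : 0 ≤ a')
    (hg' : ∀ μ z κ v i, |g μ z κ (v + Pi.single i 1) - g μ z κ v| ≤ a' * Real.exp (-(κ₀ * supNorm (quo L v - z))))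
    (μ : Fin (d + 1)) (z : Fin (d + 1) → ℤ) (κ : Fin (d + 1)) (u v : Fin (d + 1) → ℤ) :
    |g μ z κ v - g μ z κ u| ≤ (a' * Real.exp (-(κ₀ * supNorm (quo L u - z)))) * l1 (v - u) * Real.exp (κ₀ * l1 (v - u)) := by
  have hstep : ∀ (p : Fin (d + 1) → ℤ) (i : Fin (d + 1)), |g μ z κ (p + Pi.single i 1) - g μ z κ p|
      ≤ (a' * Real.exp (-(κ₀ * supNorm (quo L u - z)))) * Real.exp (κ₀ * l1 (p - u)) := by
    intro p i
    refine (hg' μ z κ p i).trans ?_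
    have hw := env_wobble (d := d) hL hκ z u p
    calc a' * Real.exp (-(κ₀ * supNorm (quo L p - z)))
        ≤ a' * (Real.exp (κ₀ * l1 (p - u)) * Real.exp (-(κ₀ * supNorm (quo L u - z)))) := mul_le_mul_of_nonneg_left hw ha'
      _ = _ := by ring
  exact abs_sub_le_of_unit_steps (f := fun v => g μ z κ v) (by positivity) hκ hstep v

/-- [folklore] A sup envelope gives a uniform bound `|g| ≤ a`. -/
theorem leg_abs_le (hκ : 0 ≤ κ₀) (ha : 0 ≤ a) (hg : ∀ μ z κ v, |g μ z κ v| ≤ a * Real.exp (-(κ₀ * supNorm (quo L v - z))))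
    (μ : Fin (d + 1)) (z : Fin (d + 1) → ℤ) (κ : Fin (d + 1)) (v : Fin (d + 1) → ℤ) : |g μ z κ v| ≤ a :=
  (hg μ z κ v).trans (by nlinarith [env_le_one (L := L) hκ z v])

/-- [folklore] A sup envelope gives summability in the fine index. -/
theorem summable_leg (hL : 1 ≤ L) (hκ : 0 < κ₀) (hg : ∀ μ z κ v, |g μ z κ v| ≤ a * Real.exp (-(κ₀ * supNorm (quo L v - z))))
    (μ : Fin (d + 1)) (z : Fin (d + 1) → ℤ) (κ : Fin (d + 1)) : Summable fun v => g μ z κ v :=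
  Summable.of_norm_bounded ((summable_env hL hκ z).mul_left a) (fun v => by rw [Real.norm_eq_abs]; exact hg μ z κ v)

end Legs

/-! ## §2 The cell oscillation of the four-leg product -/

/-- [folklore] **PRODUCT RULE** for four factors: `|x₀x₁x₂x₃ − y₀y₁y₂y₃| ≤ Σ_i Δ_i·Π_{j≠i} B_j` when `|x_j|, |y_j| ≤ B_j`, `|x_i − y_i| ≤ Δ_i`. -/
theorem abs_prod_four_sub_le {x₀ x₁ x₂ x₃ y₀ y₁ y₂ y₃ B₀ B₁ B₂ B₃ Δ₀ Δ₁ Δ₂ Δ₃ : ℝ}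
    (hx₀ : |x₀| ≤ B₀) (hx₁ : |x₁| ≤ B₁) (hx₂ : |x₂| ≤ B₂) (hx₃ : |x₃| ≤ B₃)
    (hy₀ : |y₀| ≤ B₀) (hy₁ : |y₁| ≤ B₁) (hy₂ : |y₂| ≤ B₂) (_hy₃ : |y₃| ≤ B₃)
    (h₀ : |x₀ - y₀| ≤ Δ₀) (h₁ : |x₁ - y₁| ≤ Δ₁) (h₂ : |x₂ - y₂| ≤ Δ₂) (h₃ : |x₃ - y₃| ≤ Δ₃) :
    |x₀ * x₁ * x₂ * x₃ - y₀ * y₁ * y₂ * y₃| ≤ Δ₀ * B₁ * B₂ * B₃ + B₀ * Δ₁ * B₂ * B₃ + B₀ * B₁ * Δ₂ * B₃ + B₀ * B₁ * B₂ * Δ₃ := by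
  have hB₀ : 0 ≤ B₀ := (abs_nonneg _).trans hx₀
  have hB₁ : 0 ≤ B₁ := (abs_nonneg _).trans hx₁
  have hB₂ : 0 ≤ B₂ := (abs_nonneg _).trans hx₂
  have hB₃ : 0 ≤ B₃ := (abs_nonneg _).trans hx₃
  have hΔ₀ : 0 ≤ Δ₀ := (abs_nonneg _).trans h₀
  have hΔ₁ : 0 ≤ Δ₁ := (abs_nonneg _).trans h₁
  have hΔ₂ : 0 ≤ Δ₂ := (abs_nonneg _).trans h₂
  have e : x₀ * x₁ * x₂ * x₃ - y₀ * y₁ * y₂ * y₃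
      = (x₀ - y₀) * x₁ * x₂ * x₃ + y₀ * (x₁ - y₁) * x₂ * x₃ + y₀ * y₁ * (x₂ - y₂) * x₃ + y₀ * y₁ * y₂ * (x₃ - y₃) := by ring
  rw [e]
  have t1 : |(x₀ - y₀) * x₁ * x₂ * x₃| ≤ Δ₀ * B₁ * B₂ * B₃ := by
    rw [abs_mul, abs_mul, abs_mul]
    have := abs_nonneg (x₀ - y₀); have := abs_nonneg x₁; have := abs_nonneg x₂
    exact mul_le_mul (mul_le_mul (mul_le_mul h₀ hx₁ (abs_nonneg _) (by linarith)) hx₂ (abs_nonneg _) (by positivity)) hx₃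
      (abs_nonneg _) (by positivity)
  have t2 : |y₀ * (x₁ - y₁) * x₂ * x₃| ≤ B₀ * Δ₁ * B₂ * B₃ := by
    rw [abs_mul, abs_mul, abs_mul]
    have := abs_nonneg y₀; have := abs_nonneg (x₁ - y₁); have := abs_nonneg x₂
    exact mul_le_mul (mul_le_mul (mul_le_mul hy₀ h₁ (abs_nonneg _) (by linarith)) hx₂ (abs_nonneg _) (by positivity)) hx₃
      (abs_nonneg _) (by positivity)
  have t3 : |y₀ * y₁ * (x₂ - y₂) * x₃| ≤ B₀ * B₁ * Δ₂ * B₃ := by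
    rw [abs_mul, abs_mul, abs_mul]
    have := abs_nonneg y₀; have := abs_nonneg y₁; have := abs_nonneg (x₂ - y₂)
    exact mul_le_mul (mul_le_mul (mul_le_mul hy₀ hy₁ (abs_nonneg _) (by linarith)) h₂ (abs_nonneg _) (by positivity)) hx₃
      (abs_nonneg _) (by positivity)
  have t4 : |y₀ * y₁ * y₂ * (x₃ - y₃)| ≤ B₀ * B₁ * B₂ * Δ₃ := by
    rw [abs_mul, abs_mul, abs_mul]
    have := abs_nonneg y₀; have := abs_nonneg y₁; have := abs_nonneg y₂
    exact mul_le_mul (mul_le_mul (mul_le_mul hy₀ hy₁ (abs_nonneg _) (by linarith)) hy₂ (abs_nonneg _) (by positivity)) h₃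
      (abs_nonneg _) (by positivity)
  have s := abs_add_le ((x₀ - y₀) * x₁ * x₂ * x₃ + y₀ * (x₁ - y₁) * x₂ * x₃ + y₀ * y₁ * (x₂ - y₂) * x₃) (y₀ * y₁ * y₂ * (x₃ - y₃))
  have s' := abs_add_le ((x₀ - y₀) * x₁ * x₂ * x₃ + y₀ * (x₁ - y₁) * x₂ * x₃) (y₀ * y₁ * (x₂ - y₂) * x₃)
  have s'' := abs_add_le ((x₀ - y₀) * x₁ * x₂ * x₃) (y₀ * (x₁ - y₁) * x₂ * x₃)
  linarith

/-- [folklore] An offset of the `Lc`-cell has `|toSite b|₁ ≤ (d+1)·Lc`. -/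
theorem l1_toSite_le {Lc : ℕ} {b : Fin (d + 1) → ℕ} (hb : b ∈ box (d + 1) Lc) : l1 (toSite b) ≤ ((d : ℝ) + 1) * Lc := by
  unfold l1
  calc ∑ μ, |((toSite b μ : ℤ) : ℝ)| ≤ ∑ _μ : Fin (d + 1), (Lc : ℝ) := Finset.sum_le_sum fun i _ => by
          have hbi : b i < Lc := Finset.mem_range.1 (Fintype.mem_piFinset.1 hb i)
          simp only [toSite, Int.cast_natCast, Nat.abs_cast]
          exact_mod_cast hbi.le
    _ = ((d : ℝ) + 1) * Lc := by rw [Finset.sum_const, Finset.card_univ, Fintype.card_fin, nsmul_eq_mul]; push_cast; ring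

/-- [folklore] The product of the four (N1)-type envelopes at a fine point `w` (the weight of the one free block sum).  A definition asserting nothing. -/
def env4 (L : ℕ) (κ₀ : ℝ) (y y' x' z' : Fin (d + 1) → ℤ) (w : Fin (d + 1) → ℤ) : ℝ :=
  Real.exp (-(κ₀ * supNorm (quo L w - y))) * Real.exp (-(κ₀ * supNorm (quo L w - y'))) *
    Real.exp (-(κ₀ * supNorm (quo L w - x'))) * Real.exp (-(κ₀ * supNorm (quo L w - z')))

/-- [folklore] `env4`, unfolded. -/
theorem env4_apply (L : ℕ) (κ₀ : ℝ) (y y' x' z' w : Fin (d + 1) → ℤ) :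
    env4 L κ₀ y y' x' z' w = Real.exp (-(κ₀ * supNorm (quo L w - y))) * Real.exp (-(κ₀ * supNorm (quo L w - y'))) *
      Real.exp (-(κ₀ * supNorm (quo L w - x'))) * Real.exp (-(κ₀ * supNorm (quo L w - z'))) := rfl

section Osc

variable {l r : Fin (d + 1) → (Fin (d + 1) → ℤ) → Fin (d + 1) → (Fin (d + 1) → ℤ) → ℝ} {L Lc : ℕ} {κ₀ a a' : ℝ}
  (hL : 1 ≤ L) (hκ : 0 < κ₀) (ha : 0 ≤ a) (ha' : 0 ≤ a')
  (hl : ∀ α x' κ x, |l α x' κ x| ≤ a * Real.exp (-(κ₀ * supNorm (quo L x - x'))))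
  (hr : ∀ μ z κ u, |r μ z κ u| ≤ a * Real.exp (-(κ₀ * supNorm (quo L u - z))))
  (hl' : ∀ α x' κ x i, |l α x' κ (x + Pi.single i 1) - l α x' κ x| ≤ a' * Real.exp (-(κ₀ * supNorm (quo L x - x'))))
  (hr' : ∀ μ z κ u i, |r μ z κ (u + Pi.single i 1) - r μ z κ u| ≤ a' * Real.exp (-(κ₀ * supNorm (quo L u - z))))


include hL hκ ha ha' hl hr hl' hr' in
/-- [folklore] **CELL OSCILLATION OF THE FOUR-LEG PRODUCT**: for an offset `b` with `|b|₁ ≤ ℓ`,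
`|Λ(w + b) − Λ(w)| ≤ 4·a³·a′·ℓ·e^{4κ₀ℓ}·E4(w)`, `Λ(v) := r μ y κ v · r ν y′ κ′ v · l α x′ κ₁ v · r β z′ κ₂ v`. -/
theorem abs_legs4_sub_le {ℓ : ℝ} (μ : Fin (d + 1)) (y : Fin (d + 1) → ℤ) (κ : Fin (d + 1)) (ν : Fin (d + 1)) (y' : Fin (d + 1) → ℤ)
    (κ' : Fin (d + 1)) (α : Fin (d + 1)) (x' : Fin (d + 1) → ℤ) (κ₁ : Fin (d + 1)) (β : Fin (d + 1)) (z' : Fin (d + 1) → ℤ) (κ₂ : Fin (d + 1))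
    (w b : Fin (d + 1) → ℤ) (hb : l1 b ≤ ℓ) :
    |r μ y κ (w + b) * r ν y' κ' (w + b) * l α x' κ₁ (w + b) * r β z' κ₂ (w + b) - r μ y κ w * r ν y' κ' w * l α x' κ₁ w * r β z' κ₂ w|
      ≤ 4 * a ^ 3 * a' * ℓ * Real.exp (4 * κ₀ * ℓ) * env4 L κ₀ y y' x' z' w := by
  have hκ0 := hκ.le
  have hℓ : 0 ≤ ℓ := (l1_nonneg b).trans hb
  have hwb : l1 (w + b - w) = l1 b := by rw [add_sub_cancel_left]
  -- sup bounds at `w + b` and at `w`, Lipschitz bounds, all relative to the base `w`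
  have hexp : Real.exp (κ₀ * l1 b) ≤ Real.exp (κ₀ * ℓ) := Real.exp_le_exp.2 (mul_le_mul_of_nonneg_left hb hκ0)
  have hexp1 : 1 ≤ Real.exp (κ₀ * ℓ) := Real.one_le_exp (by positivity)
  have S : ∀ {g : Fin (d + 1) → (Fin (d + 1) → ℤ) → Fin (d + 1) → (Fin (d + 1) → ℤ) → ℝ}
      (hg : ∀ μ z κ v, |g μ z κ v| ≤ a * Real.exp (-(κ₀ * supNorm (quo L v - z)))) (μ z κ),
      |g μ z κ (w + b)| ≤ a * Real.exp (κ₀ * ℓ) * Real.exp (-(κ₀ * supNorm (quo L w - z))) ∧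
      |g μ z κ w| ≤ a * Real.exp (κ₀ * ℓ) * Real.exp (-(κ₀ * supNorm (quo L w - z))) := by
    intro g hg μ z κ
    have h1 := leg_rel_sup hL hκ0 ha hg μ z κ w (w + b)
    rw [hwb] at h1
    have h2 := hg μ z κ w
    have hE := (Real.exp_pos (-(κ₀ * supNorm (quo L w - z)))).le
    constructor
    · refine h1.trans ?_
      calc a * Real.exp (-(κ₀ * supNorm (quo L w - z))) * Real.exp (κ₀ * l1 b)
          ≤ a * Real.exp (-(κ₀ * supNorm (quo L w - z))) * Real.exp (κ₀ * ℓ) := mul_le_mul_of_nonneg_left hexp (by positivity)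
        _ = _ := by ring
    · refine h2.trans ?_
      calc a * Real.exp (-(κ₀ * supNorm (quo L w - z))) = a * 1 * Real.exp (-(κ₀ * supNorm (quo L w - z))) := by ring
        _ ≤ a * Real.exp (κ₀ * ℓ) * Real.exp (-(κ₀ * supNorm (quo L w - z))) := by gcongr
  have D : ∀ {g : Fin (d + 1) → (Fin (d + 1) → ℤ) → Fin (d + 1) → (Fin (d + 1) → ℤ) → ℝ}
      (hg' : ∀ μ z κ v i, |g μ z κ (v + Pi.single i 1) - g μ z κ v| ≤ a' * Real.exp (-(κ₀ * supNorm (quo L v - z)))) (μ z κ),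
      |g μ z κ (w + b) - g μ z κ w| ≤ a' * ℓ * Real.exp (κ₀ * ℓ) * Real.exp (-(κ₀ * supNorm (quo L w - z))) := by
    intro g hg' μ z κ
    have h1 := leg_rel_lip hL hκ0 ha' hg' μ z κ w (w + b)
    rw [hwb] at h1
    refine h1.trans ?_
    have hE := (Real.exp_pos (-(κ₀ * supNorm (quo L w - z)))).le
    calc a' * Real.exp (-(κ₀ * supNorm (quo L w - z))) * l1 b * Real.exp (κ₀ * l1 b)
        ≤ a' * Real.exp (-(κ₀ * supNorm (quo L w - z))) * ℓ * Real.exp (κ₀ * ℓ) := by gcongr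
      _ = _ := by ring
  obtain ⟨s0, t0⟩ := S hr μ y κ
  obtain ⟨s1, t1⟩ := S hr ν y' κ'
  obtain ⟨s2, t2⟩ := S hl α x' κ₁
  obtain ⟨s3, t3⟩ := S hr β z' κ₂
  have d0 := D hr' μ y κ
  have d1 := D hr' ν y' κ'
  have d2 := D hl' α x' κ₁
  have d3 := D hr' β z' κ₂
  have key := abs_prod_four_sub_le s0 s1 s2 s3 t0 t1 t2 t3 d0 d1 d2 d3
  refine key.trans (le_of_eq ?_)
  have e4 : Real.exp (4 * κ₀ * ℓ) = Real.exp (κ₀ * ℓ) * Real.exp (κ₀ * ℓ) * Real.exp (κ₀ * ℓ) * Real.exp (κ₀ * ℓ) := by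
    rw [← Real.exp_add, ← Real.exp_add, ← Real.exp_add]; congr 1; ring
  rw [e4, env4_apply]
  ring

include hκ in
/-- [folklore] **THE SUBLATTICE SUM OF THE FOUR ENVELOPES**: `Σ'_t E4(Lc•t) ≤ e^{4κ₀(d+1)Lc}·(Lc^{d+1})⁻¹·Σ'_u E4(u)` (wobble every sublattice point
back to each of the `Lc^{d+1}` points of its cell; `BiStencilZeroMode.tsum_eq_sum_box_tsum`). -/
theorem tsum_env4_sublattice_le [NeZero Lc] (hL : 1 ≤ L) (y y' x' z' : Fin (d + 1) → ℤ)
    (hs : Summable (env4 L κ₀ y y' x' z')) :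
    (Summable fun t : Fin (d + 1) → ℤ => env4 L κ₀ y y' x' z' ((Lc : ℤ) • t)) ∧
    ∑' t : Fin (d + 1) → ℤ, env4 L κ₀ y y' x' z' ((Lc : ℤ) • t)
      ≤ Real.exp (4 * κ₀ * (((d : ℝ) + 1) * Lc)) * ((Lc : ℝ) ^ (d + 1))⁻¹ * ∑' u : Fin (d + 1) → ℤ, env4 L κ₀ y y' x' z' u := by
  have hκ0 := hκ.le
  have hLc : (0 : ℝ) < (Lc : ℝ) ^ (d + 1) := by
    have : (0 : ℝ) < Lc := by exact_mod_cast Nat.pos_of_ne_zero (NeZero.ne Lc)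
    positivity
  -- summability on the sublattice: a subseries
  have hsub : ∀ b : Fin (d + 1) → ℕ, Summable fun t : Fin (d + 1) → ℤ => env4 L κ₀ y y' x' z' ((Lc : ℤ) • t + toSite b) :=
    fun b => hs.comp_injective (sublattice_injective Lc (toSite b))
  have hs0 : Summable fun t : Fin (d + 1) → ℤ => env4 L κ₀ y y' x' z' ((Lc : ℤ) • t) := by
    have h := hsub (fun _ => 0)
    have e0 : toSite (d := d + 1) (fun _ => 0) = 0 := by funext i; simp [toSite]
    simpa [e0] using h
  refine ⟨hs0, ?_⟩
  -- wobble back: `E4(Lc•t) ≤ e^{4κ₀ℓ}·E4(Lc•t + b)` for every cell offset `b`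
  set ℓ : ℝ := ((d : ℝ) + 1) * Lc with hℓ
  have hwob : ∀ b ∈ box (d + 1) Lc, ∀ t : Fin (d + 1) → ℤ,
      env4 L κ₀ y y' x' z' ((Lc : ℤ) • t) ≤ Real.exp (4 * κ₀ * ℓ) * env4 L κ₀ y y' x' z' ((Lc : ℤ) • t + toSite b) := by
    intro b hb t
    have hbl : l1 (toSite b) ≤ ℓ := l1_toSite_le hb
    have one : ∀ z, Real.exp (-(κ₀ * supNorm (quo L ((Lc : ℤ) • t) - z)))
        ≤ Real.exp (κ₀ * ℓ) * Real.exp (-(κ₀ * supNorm (quo L ((Lc : ℤ) • t + toSite b) - z))) := by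
      intro z
      have hw := env_wobble (d := d) hL hκ0 z ((Lc : ℤ) • t + toSite b) ((Lc : ℤ) • t)
      have el : l1 ((Lc : ℤ) • t - ((Lc : ℤ) • t + toSite b)) = l1 (toSite b) := by
        rw [show (Lc : ℤ) • t - ((Lc : ℤ) • t + toSite b) = -toSite b by abel]
        unfold l1; simp only [Pi.neg_apply, Int.cast_neg, abs_neg]
      rw [el] at hw
      refine hw.trans (mul_le_mul_of_nonneg_right (Real.exp_le_exp.2 (mul_le_mul_of_nonneg_left hbl hκ0)) (Real.exp_pos _).le)
    rw [env4_apply, env4_apply]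
    have p0 := one y; have p1 := one y'; have p2 := one x'; have p3 := one z'
    have e4 : Real.exp (4 * κ₀ * ℓ) = Real.exp (κ₀ * ℓ) * Real.exp (κ₀ * ℓ) * Real.exp (κ₀ * ℓ) * Real.exp (κ₀ * ℓ) := by
      rw [← Real.exp_add, ← Real.exp_add, ← Real.exp_add]; congr 1; ring
    rw [e4]
    have n0 := (Real.exp_pos (-(κ₀ * supNorm (quo L ((Lc : ℤ) • t) - y)))).le
    have n1 := (Real.exp_pos (-(κ₀ * supNorm (quo L ((Lc : ℤ) • t) - y')))).le
    have n2 := (Real.exp_pos (-(κ₀ * supNorm (quo L ((Lc : ℤ) • t) - x')))).le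
    calc _ ≤ (Real.exp (κ₀ * ℓ) * Real.exp (-(κ₀ * supNorm (quo L ((Lc : ℤ) • t + toSite b) - y)))) *
          (Real.exp (κ₀ * ℓ) * Real.exp (-(κ₀ * supNorm (quo L ((Lc : ℤ) • t + toSite b) - y')))) *
          (Real.exp (κ₀ * ℓ) * Real.exp (-(κ₀ * supNorm (quo L ((Lc : ℤ) • t + toSite b) - x')))) *
          (Real.exp (κ₀ * ℓ) * Real.exp (-(κ₀ * supNorm (quo L ((Lc : ℤ) • t + toSite b) - z')))) := by
            gcongr
      _ = _ := by ring
  -- sum over `t`, average over the cell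
  have hcard : ((box (d + 1) Lc).card : ℝ) = (Lc : ℝ) ^ (d + 1) := by
    unfold AffineAveraging.box
    rw [Fintype.card_piFinset, Finset.prod_const, Finset.card_range, Finset.card_univ, Fintype.card_fin]
    push_cast
    rfl
  have hcell := tsum_eq_sum_box_tsum (N := Lc) hs
  have key : (Lc : ℝ) ^ (d + 1) * ∑' t : Fin (d + 1) → ℤ, env4 L κ₀ y y' x' z' ((Lc : ℤ) • t)
      ≤ Real.exp (4 * κ₀ * ℓ) * ∑' u : Fin (d + 1) → ℤ, env4 L κ₀ y y' x' z' u := by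
    rw [hcell, Finset.mul_sum, ← hcard, ← nsmul_eq_mul, ← Finset.sum_const]
    refine Finset.sum_le_sum fun b hb => ?_
    rw [← tsum_mul_left]
    exact Summable.tsum_le_tsum (hwob b hb) hs0 ((hsub b).mul_left _)
  calc ∑' t : Fin (d + 1) → ℤ, env4 L κ₀ y y' x' z' ((Lc : ℤ) • t)
      ≤ (Real.exp (4 * κ₀ * ℓ) * ∑' u : Fin (d + 1) → ℤ, env4 L κ₀ y y' x' z' u) / (Lc : ℝ) ^ (d + 1) := (le_div_iff₀' hLc).2 key
    _ = _ := by rw [hℓ]; ring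

end Osc

/-! ## §3 The oscillation step -/

section OscStep

variable {Λ S : (Fin (d + 1) → ℤ) → ℝ} {Lc : ℕ} {BΛ BS ω : ℝ} {E : (Fin (d + 1) → ℤ) → ℝ}

/-- [folklore] **THE OSCILLATION STEP** (abstract): a summable weight `Λ` with `|Λ| ≤ B_Λ·E` against an `Lc`-PERIODIC function `S` of ZERO CELL SUM and
`|S| ≤ B_S` sees only the cell oscillation of `Λ`: if `|Λ(Lc•t + b) − Λ(Lc•t)| ≤ ω·E(Lc•t)` for every cell offset `b`, then
`|Σ'_u Λ u·S u| ≤ Lc^{d+1}·B_S·ω·Σ'_t E(Lc•t)`. -/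
theorem abs_tsum_mul_periodic_zero_le [NeZero Lc] (hΛ : Summable Λ) (hBS : 0 ≤ BS)
    (hS : ∀ u, |S u| ≤ BS) (hper : ∀ u t, S (u + (Lc : ℤ) • t) = S u) (hzero : ∑ b ∈ box (d + 1) Lc, S (toSite b) = 0)
    (hE : Summable fun t : Fin (d + 1) → ℤ => E ((Lc : ℤ) • t))
    (hosc : ∀ b ∈ box (d + 1) Lc, ∀ t : Fin (d + 1) → ℤ, |Λ ((Lc : ℤ) • t + toSite b) - Λ ((Lc : ℤ) • t)| ≤ ω * E ((Lc : ℤ) • t)) :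
    |∑' u, Λ u * S u| ≤ (Lc : ℝ) ^ (d + 1) * BS * (ω * ∑' t : Fin (d + 1) → ℤ, E ((Lc : ℤ) • t)) := by
  have hΛS : Summable fun u => Λ u * S u :=
    Summable.of_norm_bounded (hΛ.abs.mul_right BS) (fun u => by
      rw [Real.norm_eq_abs, abs_mul]; exact mul_le_mul_of_nonneg_left (hS u) (abs_nonneg _))
  rw [tsum_mul_periodic (N := Lc) hper hΛS]
  -- subtract `(Σ_b S b)·Σ'_t Λ(Lc•t) = 0`
  have hsub : ∀ b : Fin (d + 1) → ℕ, Summable fun t : Fin (d + 1) → ℤ => Λ ((Lc : ℤ) • t + toSite b) :=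
    fun b => hΛ.comp_injective (sublattice_injective Lc (toSite b))
  have hs0 : Summable fun t : Fin (d + 1) → ℤ => Λ ((Lc : ℤ) • t) := by
    have h := hsub (fun _ => 0)
    have e0 : toSite (d := d + 1) (fun _ => 0) = 0 := by funext i; simp [toSite]
    simpa [e0] using h
  have hz : ∑ b ∈ box (d + 1) Lc, S (toSite b) * ∑' t : Fin (d + 1) → ℤ, Λ ((Lc : ℤ) • t) = 0 := by
    rw [← Finset.sum_mul, hzero, zero_mul]
  rw [← sub_zero (∑ b ∈ box (d + 1) Lc, S (toSite b) * ∑' t : Fin (d + 1) → ℤ, Λ ((Lc : ℤ) • t + toSite b)), ← hz,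
    ← Finset.sum_sub_distrib]
  have hcard : ((box (d + 1) Lc).card : ℝ) = (Lc : ℝ) ^ (d + 1) := by
    unfold AffineAveraging.box
    rw [Fintype.card_piFinset, Finset.prod_const, Finset.card_range, Finset.card_univ, Fintype.card_fin]
    push_cast
    rfl
  calc |∑ b ∈ box (d + 1) Lc, (S (toSite b) * ∑' t : Fin (d + 1) → ℤ, Λ ((Lc : ℤ) • t + toSite b)
          - S (toSite b) * ∑' t : Fin (d + 1) → ℤ, Λ ((Lc : ℤ) • t))|
      ≤ ∑ b ∈ box (d + 1) Lc, |S (toSite b) * ∑' t : Fin (d + 1) → ℤ, Λ ((Lc : ℤ) • t + toSite b)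
          - S (toSite b) * ∑' t : Fin (d + 1) → ℤ, Λ ((Lc : ℤ) • t)| := Finset.abs_sum_le_sum_abs _ _
    _ ≤ ∑ _b ∈ box (d + 1) Lc, BS * (ω * ∑' t : Fin (d + 1) → ℤ, E ((Lc : ℤ) • t)) := Finset.sum_le_sum fun b hb => by
        rw [← mul_sub, abs_mul, ← (hsub b).tsum_sub hs0]
        refine mul_le_mul (hS _) ?_ (abs_nonneg _) hBS
        have hb2 := tsum_of_norm_bounded ((hE.mul_left ω).hasSum)
          (f := fun t : Fin (d + 1) → ℤ => Λ ((Lc : ℤ) • t + toSite b) - Λ ((Lc : ℤ) • t))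
          (fun t => by rw [Real.norm_eq_abs]; exact hosc b hb t)
        rw [Real.norm_eq_abs] at hb2
        refine hb2.trans (le_of_eq ?_)
        rw [tsum_mul_left]
    _ = _ := by rw [Finset.sum_const, nsmul_eq_mul, hcard]; ring

end OscStep

end Summit.QuantumFields.BalabanUV.Beta.GAN24.Push4Oscillation

end
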